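import Literature.MathematicalPhysics.QuantumFieldTheory.Federbush1986.GoodSquareTranslates
import Literature.MathematicalPhysics.QuantumFieldTheory.Federbush1986.LocalStabilitySU2DBonds

/-!
# Federbush [F3] §5.3 step 11) p. 305, the selection of the `c₁₀` good translates READ ON THE SCHEME'S INDEX SET — squares
# `k : Fin (N^{d+2})`, corners `x_k ∈ B(0)` (`xOfD`), displacement along the last axis `e_{d+1}`: the fields `F`, `card_F`,
# `mult_le` of p32's `Regime2Datum` with removed-point-free interiors, contours and slabs, off an `O(N)` exclusion set

statement-level skeleton of published theorems with citation tags; proofs where landed; nothing here is a claim about the Yang–Mills mass gap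

SOURCE. [Federbush1987PhaseCellIII] P. Federbush, *A phase cell approach to Yang–Mills theory III. Local stability, modified
renormalization group transformation*, Commun. Math. Phys. **110** (1987) 293–309 (held `paper:url-4700a514f365`), p. 305 §5.3
11): *«We pick one of the two lattice directions, say n, perpendicular to the plane of P. To each bad square, say BS, we find c₁₀
good squares GS_α that are each parallel displacements of BS in the direction of n. We can also require that the distance between
BS and each GS_α is ≦ c₁₁ lattice spacings.»*; p. 304 6): *«This requires a reasonable choice of the balls in 1) and a reasonable
choice of the additional bonds and vertices removed in 2).»*

CITATION HEADER (lean-in-tree rule).  lit-balaban cell (HOME `run/shared/lean/pub/lit-balaban/`), Phase-2 proof seat p26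
(gen 16; free-target protocol G.5-34(d)), SKELETON row **F3.Eq5.26-5.40** (owner r17, referee ref-5; head `typed`, unchanged).
This file is the thin index-level corollary of this seat's `GoodSquareTranslates` (`exists_goodTranslates_family`: the lattice-
level selection theorem with the exclusion count) for the index set of p32's group-generic Regime-2 scheme (`LocalStabilityG`,
`Regime2GScheme`/`Regime2NiceData`/`Regime2RadialSquare`: squares indexed by `Fin (N^{d+2})` through `finFunctionFinEquiv`, corner
`xOfD d N x ∈ block N 0` (`LocalStabilitySU2DBonds.xOfD_mem_block`), square loop `rectLoop (xOfD x) (dir0) (dir1) N N`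
(`Regime2RadialSquare.dist_one_rsq`), displacement along the last axis as in `SquareSlideChain`).  Companions BY NAME (none
edited): `GoodSquareReweighting536` (`mult`, `mult_le_of_translates`), `ContourSlideHomotopy` (`slabPlaqs`), `Lemma54RectangleStokes`
(`rectLoop`, `rectPlaqs`).

WHAT IS PROVED: `corner`/`idx` (the bijection between `Fin (N^{d+2})` and the block of corners `B(0)`: `corner_idx`, `idx_corner`,
`corner_injective`, `idx_injOn`), `last_ne_zero_one` (the last axis is perpendicular to the plane `(e₀, e₁)` once `d ≧ 1`), and
**`exists_goodTranslates_idx`**: for removed base points `D`, spoiled corners `Sp`, `c₁₀ + q + #D ≦ c₁₁`, `2c₁₁ + 1 ≦ N`, `d ≧ 1`,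
there are `X : Finset (Fin (N^{d+2}))` with `#X ≦ (2c₁₁+1)·4N·#D + (2c₁₁+1)·#Sp/(q+1)` and `F : Fin (N^{d+2}) → Finset (Fin (N^{d+2}))`
with, for every `k ∉ X`, `#F k = c₁₀` indices whose corners are translates `corner k + j e_{d+1}`, `0 < |j| ≦ c₁₁`, not spoiled,
interiors/contours/slabs based outside `D` (the slab swept from the lower square), and `GoodSquareReweighting.mult Bad F g ≦
2c₁₁ + 1` for all `Bad`, `g`.  (v1.1) **`mult_idx_le_card_removed`**: `mult Bad F g ≦ #D` when the bad squares are the ones with an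
interior plaquette based in `D` and the families are translates along the last axis — (5.37) with `ε = #D/c₁₀` (transport of
`GoodSquareTranslates.mult_le_card_removed`); the slab geometry `endpoints_mem_square_of_mem_rectLoop`, `slab_vertices_mem_box`
(the slab swept by the displacement stays over the square) and **`inBoxZ_slab`** (in the scheme the slab between two squares of the
block lies in the four blocks `InBoxZ` — with `Regime2SfBridge.absG_plaqLoop_lt_of_not_mem` this turns «slab based outside the removed
set» into the s.f. hypothesis of `ContourSlideHomotopy.dist_wordHol_slideWordN_le`, see `GoodSquareTranslatesSf`).

HONEST SCOPE.  Pure transport of `GoodSquareTranslates.exists_goodTranslates_family` along the corner bijection; the reading of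
step 6)'s «reasonable choice» as the exclusion set is discussed there (HOME/GAPS.md G-F3-p26-02).  Two small `def`s with bodies
(`corner`, `idx`), no `def … : Prop`, no `sorry`; axioms standard.  Unit `lit-balaban-p26` (literature-prover-lit-balaban-p26-g16-0).
-/

namespace Literature.MathematicalPhysics.QuantumFieldTheory.Federbush1986

namespace GoodSquareTranslates

open LatticeContour Regime2SquareCounts
open Literature.MathematicalPhysics.QuantumFieldTheory.Balaban1983to89.B6Elimination (block mem_block)

section Scheme

open LocalStabilitySU2D (xOfD xOfD_mem_block)

variable (d N : ℕ)

/-- The corner of the square of index `k` (p32's `LocalStabilityG` scheme: `x_k ∈ B(0) = {0,…,N−1}^{d+2}`).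
[cite: Federbush1987PhaseCellIII, (5.34) p. 304] -/
def corner (k : Fin (N ^ (d + 2))) : Site (d + 2) := xOfD d N (finFunctionFinEquiv.symm k)

/-- The index of a corner of the block `B(0)` (inverse of `corner` there). [cite: Federbush1987PhaseCellIII, (5.34) p. 304] -/
def idx (hN : 0 < N) (y : Site (d + 2)) : Fin (N ^ (d + 2)) :=
  finFunctionFinEquiv fun i => ⟨(y i).toNat % N, Nat.mod_lt _ hN⟩

/-- Corners lie in the block `B(0)`. [cite: Federbush1987PhaseCellIII, §5.3 1) p. 303] -/
theorem corner_mem_block (k : Fin (N ^ (d + 2))) : corner d N k ∈ block N (0 : Site (d + 2)) :=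
  xOfD_mem_block d N _

/-- `corner ∘ idx = id` on the block. [cite: Federbush1987PhaseCellIII, (5.34) p. 304] -/
theorem corner_idx (hN : 0 < N) {y : Site (d + 2)} (hy : y ∈ block N (0 : Site (d + 2))) : corner d N (idx d N hN y) = y := by
  funext i
  obtain ⟨h0, h1⟩ := mem_block.1 hy i
  simp only [Pi.zero_apply, zero_add] at h0 h1
  have ht : ((y i).toNat : ℤ) = y i := Int.toNat_of_nonneg h0
  have hlt : (y i).toNat < N := by omega
  simp [corner, idx, xOfD, Nat.mod_eq_of_lt hlt, ht]

/-- `corner` is injective (block coordinates are faithful). [cite: Federbush1987PhaseCellIII, (5.34) p. 304] -/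
theorem corner_injective : Function.Injective (corner d N) := by
  intro k k' h
  apply finFunctionFinEquiv.symm.injective
  funext i
  have := congrFun h i
  simp only [corner, xOfD, Nat.cast_inj] at this
  exact Fin.ext this

/-- `idx ∘ corner = id`. [cite: Federbush1987PhaseCellIII, (5.34) p. 304] -/
theorem idx_corner (hN : 0 < N) (k : Fin (N ^ (d + 2))) : idx d N hN (corner d N k) = k :=
  corner_injective d N (corner_idx d N hN (corner_mem_block d N k))

/-- `idx` is injective on the block. [cite: Federbush1987PhaseCellIII, (5.34) p. 304] -/
theorem idx_injOn (hN : 0 < N) : Set.InjOn (idx d N hN) (block N (0 : Site (d + 2)) : Finset (Site (d + 2))) := by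
  intro y hy y' hy' h
  rw [← corner_idx d N hN (Finset.mem_coe.1 hy), ← corner_idx d N hN (Finset.mem_coe.1 hy'), h]

/-- The last axis `e_{d+1}` is perpendicular to the plane `(e₀, e₁)` of `P` when `d ≧ 1` (print: `d + 2 = 4`).
[cite: Federbush1987PhaseCellIII, §5.3 11) p. 305] -/
theorem last_ne_zero_one (hd : 1 ≤ d) : (Fin.last (d + 1) : Fin (d + 2)) ≠ 0 ∧ (Fin.last (d + 1) : Fin (d + 2)) ≠ 1 := by
  refine ⟨fun h => ?_, fun h => ?_⟩
  · have := congrArg Fin.val h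
    simp at this
  · have := congrArg Fin.val h
    simp at this
    omega

/-- **Step 11) with the reasonable choice, read on the scheme's index set.**  For removed base points `D`, spoiled corners `Sp`,
`c₁₀ + q + #D ≦ c₁₁`, `2c₁₁ + 1 ≦ N`, `d ≧ 1`: an exclusion set `X` of square indices with
`#X ≦ (2c₁₁+1)·4N·#D + (2c₁₁+1)·#Sp/(q+1)` and families `F : Fin (N^{d+2}) → Finset (Fin (N^{d+2}))` such that every index `k ∉ X`
has `#F k = c₁₀` indices whose corners are translates of `corner k` along the last axis at distance `≦ c₁₁`, not spoiled, with
interiors `rectPlaqs · 0 1 N N`, contours `rectLoop · 0 1 N N` and the slab between the two squares based outside `D`; and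
`mult Bad F g ≦ 2c₁₁ + 1` — the fields `F`, `card_F`, `mult_le` of `Regime2Datum` over `Fin n`, `n = N^{d+2}`.
[cite: Federbush1987PhaseCellIII, §5.3 6) p. 304, 11) (5.39)–(5.40) p. 305] -/
theorem exists_goodTranslates_idx (hd : 1 ≤ d) (D Sp : Finset (Site (d + 2))) {c10 q c11 : ℕ}
    (hc : c10 + q + D.card ≤ c11) (hN : 2 * c11 + 1 ≤ N) :
    ∃ (X : Finset (Fin (N ^ (d + 2)))) (F : Fin (N ^ (d + 2)) → Finset (Fin (N ^ (d + 2)))),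
      X.card ≤ (2 * c11 + 1) * (4 * N) * D.card + (2 * c11 + 1) * Sp.card / (q + 1) ∧
      (∀ k, k ∉ X → (F k).card = c10 ∧ ∀ k' ∈ F k, corner d N k' ∉ Sp ∧
        (∃ j : ℤ, |j| ≤ c11 ∧ corner d N k' = corner d N k + j • ev (Fin.last (d + 1))) ∧
        (∀ p ∈ rectPlaqs (corner d N k') 0 1 N N, p.1 ∉ D) ∧ (∀ l ∈ rectLoop (corner d N k') 0 1 N N, l.1.1 ∉ D) ∧
        ∃ t : ℕ, 0 < t ∧ t ≤ c11 ∧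
          ((corner d N k' = corner d N k + (t : ℤ) • ev (Fin.last (d + 1)) ∧
              ∀ q' ∈ slabPlaqs (Fin.last (d + 1)) (rectLoop (corner d N k) 0 1 N N) t, q'.1 ∉ D) ∨
           (corner d N k' = corner d N k + (-(t : ℤ)) • ev (Fin.last (d + 1)) ∧
              ∀ q' ∈ slabPlaqs (Fin.last (d + 1)) (rectLoop (corner d N k') 0 1 N N) t, q'.1 ∉ D))) ∧
      ∀ (Bad : Finset (Fin (N ^ (d + 2)))) (g : Fin (N ^ (d + 2))), GoodSquareReweighting.mult Bad F g ≤ 2 * c11 + 1 := by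
  classical
  have hN0 : 0 < N := by omega
  obtain ⟨hℓ0, hℓ1⟩ := last_ne_zero_one d hd
  obtain ⟨X₀, F₀, -, hX₀c, hF₀, hmult₀⟩ :=
    exists_goodTranslates_family D Sp (μ := (0 : Fin (d + 2))) (ν := 1) hℓ0 hℓ1 hc hN (0 : Site (d + 2))
  -- the index-level family: empty on the excluded corners, the transported family elsewhere
  set F : Fin (N ^ (d + 2)) → Finset (Fin (N ^ (d + 2))) :=
    fun k => if corner d N k ∈ X₀ then ∅ else (F₀ (corner d N k)).image (idx d N hN0) with hFdef
  have hsub : ∀ k, corner d N k ∉ X₀ → F₀ (corner d N k) ⊆ block N (0 : Site (d + 2)) := fun k hk g hg =>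
    ((hF₀ (corner d N k) (corner_mem_block d N k) hk).2 g hg).1
  refine ⟨X₀.image (idx d N hN0), F, ?_, ?_, ?_⟩
  · exact Finset.card_image_le.trans hX₀c
  · intro k hk
    have hkX : corner d N k ∉ X₀ := fun h => hk (Finset.mem_image.2 ⟨_, h, idx_corner d N hN0 k⟩)
    obtain ⟨hcard, hF⟩ := hF₀ (corner d N k) (corner_mem_block d N k) hkX
    have hFk : F k = (F₀ (corner d N k)).image (idx d N hN0) := by rw [hFdef]; exact if_neg hkX
    refine ⟨?_, fun k' hk' => ?_⟩
    · rw [hFk, Finset.card_image_of_injOn ((idx_injOn d N hN0).mono (Finset.coe_subset.2 (hsub k hkX))), hcard]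
    · rw [hFk] at hk'
      obtain ⟨g, hg, rfl⟩ := Finset.mem_image.1 hk'
      rw [corner_idx d N hN0 (hsub k hkX hg)]
      obtain ⟨-, hsp, hj, hint, hbd, hslab⟩ := hF g hg
      exact ⟨hsp, hj, hint, hbd, hslab⟩
  · intro Bad g
    -- `mult` on indices is at most `mult` on corners
    have hle : GoodSquareReweighting.mult Bad F g ≤ GoodSquareReweighting.mult (Bad.image (corner d N)) F₀ (corner d N g) := by
      rw [GoodSquareReweighting.mult_def, GoodSquareReweighting.mult_def]
      refine Finset.card_le_card_of_injOn (corner d N) (fun b hb => ?_) (corner_injective d N).injOn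
      rw [Finset.mem_coe, Finset.mem_filter] at hb ⊢
      obtain ⟨hbB, hgF⟩ := hb
      have hbX : corner d N b ∉ X₀ := by
        intro h
        rw [hFdef] at hgF
        simp only [h, if_true] at hgF
        simp at hgF
      have hFb : F b = (F₀ (corner d N b)).image (idx d N hN0) := by rw [hFdef]; exact if_neg hbX
      rw [hFb] at hgF
      obtain ⟨g₀, hg₀, hidx⟩ := Finset.mem_image.1 hgF
      refine ⟨Finset.mem_image_of_mem _ hbB, ?_⟩
      rw [← hidx, corner_idx d N hN0 (hsub b hbX hg₀)]
      exact hg₀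
    exact hle.trans (hmult₀ _ _)

/-! ## (v1.1) The multiplicity on the index set is at most `#D`: (5.37) with `ε = #D/c₁₀` -/

/-- **Index-level order of constants of (5.37).**  If every square of `Bad` has an interior plaquette (of `rectPlaqs (corner b)
0 1 N N`) based at a removed point and every family `F b` consists of indices whose corners are translates of `corner b` along
the last axis, then `mult Bad F g ≦ #D` for EVERY index `g` — transport of `GoodSquareTranslates.mult_le_card_removed` along
`corner`; with `#D ≦ r₁` this is the `m` of `Regime2Datum.mult_le` with `m/c₁₀ ≦ ε` for «c₁₀ … large enough (as a function of
ε)». [cite: Federbush1987PhaseCellIII, §5.3 10)–11) (5.37) p. 305] -/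
theorem mult_idx_le_card_removed (hd : 1 ≤ d) (hN : 0 < N) (D : Finset (LatticeContour.Site (d + 2))) (Bad : Finset (Fin (N ^ (d + 2))))
    (F : Fin (N ^ (d + 2)) → Finset (Fin (N ^ (d + 2))))
    (hBad : ∀ b ∈ Bad, ∃ p ∈ rectPlaqs (corner d N b) 0 1 N N, p.1 ∈ D)
    (hF : ∀ b ∈ Bad, ∀ g ∈ F b, ∃ j : ℤ, corner d N g = corner d N b + j • ev (Fin.last (d + 1)))
    (g : Fin (N ^ (d + 2))) :
    GoodSquareReweighting.mult Bad F g ≤ D.card := by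
  classical
  obtain ⟨hℓ0, hℓ1⟩ := last_ne_zero_one d hd
  -- the corner-level family
  set F' : LatticeContour.Site (d + 2) → Finset (LatticeContour.Site (d + 2)) := fun y => (F (idx d N hN y)).image (corner d N) with hF'
  have hle : GoodSquareReweighting.mult Bad F g ≤ GoodSquareReweighting.mult (Bad.image (corner d N)) F' (corner d N g) := by
    rw [GoodSquareReweighting.mult_def, GoodSquareReweighting.mult_def]
    refine Finset.card_le_card_of_injOn (corner d N) (fun b hb => ?_) (corner_injective d N).injOn
    rw [Finset.mem_coe, Finset.mem_filter] at hb ⊢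
    obtain ⟨hbB, hgF⟩ := hb
    refine ⟨Finset.mem_image_of_mem _ hbB, ?_⟩
    simp only [hF', idx_corner d N hN b]
    exact Finset.mem_image_of_mem _ hgF
  refine hle.trans (mult_le_card_removed D (Bad.image (corner d N)) F' hℓ0 hℓ1 N ?_ ?_ (corner d N g))
  · intro y hy
    obtain ⟨b, hb, rfl⟩ := Finset.mem_image.1 hy
    exact hBad b hb
  · intro y hy g' hg'
    obtain ⟨b, hb, rfl⟩ := Finset.mem_image.1 hy
    simp only [hF', idx_corner d N hN b] at hg'
    obtain ⟨g₁, hg₁, rfl⟩ := Finset.mem_image.1 hg'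
    exact hF b hb g₁ hg₁

end Scheme

/-! ## (v1.1) The slab plaquettes stay in the four blocks, hence are s.f. once based outside the removed set -/

section SlabBox

variable {d' : ℕ}

/-- The endpoints of every bond of the square contour `rectLoop y μ ν N N` lie in the closed square `[y, y + N e_μ + N e_ν]`
(coordinatewise). [cite: Federbush1987PhaseCellIII, §5.1 Fig. 5 p. 300, §5.3 11) p. 305] -/
theorem endpoints_mem_square_of_mem_rectLoop (y : LatticeContour.Site d') (μ ν : Fin d') (N : ℕ) {l : Letter d'}
    (hl : l ∈ rectLoop y μ ν N N) :
    (∀ i, y i ≤ l.1.1 i ∧ l.1.1 i ≤ (y + (N : ℤ) • ev μ + (N : ℤ) • ev ν) i) ∧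
      ∀ i, y i ≤ (l.1.1 + ev l.1.2) i ∧ (l.1.1 + ev l.1.2) i ≤ (y + (N : ℤ) • ev μ + (N : ℤ) • ev ν) i := by
  unfold rectLoop at hl
  simp only [List.mem_append] at hl
  rcases hl with ((hl | hl) | hl) | hl
  · obtain ⟨a, ha, rfl⟩ := mem_seg.1 hl
    refine ⟨fun i => ?_, fun i => ?_⟩ <;>
      simp only [Pi.add_apply, Pi.smul_apply, smul_eq_mul, ev_apply] <;> split_ifs <;> constructor <;> omega
  · obtain ⟨b, hb, rfl⟩ := mem_seg.1 hl
    refine ⟨fun i => ?_, fun i => ?_⟩ <;>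
      simp only [Pi.add_apply, Pi.smul_apply, smul_eq_mul, ev_apply] <;> split_ifs <;> constructor <;> omega
  · obtain ⟨l', hl', he⟩ := exists_mem_of_mem_rev hl
    obtain ⟨a, ha, rfl⟩ := mem_seg.1 hl'
    have h1 : l.1.1 = y + (N : ℤ) • ev ν + (a : ℤ) • ev μ := by rw [← he]
    have h2 : l.1.2 = μ := by rw [← he]
    rw [h1, h2]
    refine ⟨fun i => ?_, fun i => ?_⟩ <;>
      simp only [Pi.add_apply, Pi.smul_apply, smul_eq_mul, ev_apply] <;> split_ifs <;> constructor <;> omega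
  · obtain ⟨l', hl', he⟩ := exists_mem_of_mem_rev hl
    obtain ⟨b, hb, rfl⟩ := mem_seg.1 hl'
    have h1 : l.1.1 = y + (b : ℤ) • ev ν := by rw [← he]
    have h2 : l.1.2 = ν := by rw [← he]
    rw [h1, h2]
    refine ⟨fun i => ?_, fun i => ?_⟩ <;>
      simp only [Pi.add_apply, Pi.smul_apply, smul_eq_mul, ev_apply] <;> split_ifs <;> constructor <;> omega

/-- Raising a point of a box by `k' ≦ t` steps along `e_ℓ` keeps it in the box raised by `t e_ℓ`.
[cite: Federbush1987PhaseCellIII, §5.3 11) p. 305] -/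
theorem shift_mem_box {y w H : LatticeContour.Site d'} (hw : ∀ i, y i ≤ w i ∧ w i ≤ H i) (ℓ : Fin d') {k' : ℤ} {t : ℕ} (hk : 0 ≤ k')
    (hkt : k' ≤ t) : ∀ i, y i ≤ (w + k' • ev ℓ) i ∧ (w + k' • ev ℓ) i ≤ (H + (t : ℤ) • ev ℓ) i := by
  intro i
  have h := hw i
  simp only [Pi.add_apply, Pi.smul_apply, smul_eq_mul, ev_apply]
  split_ifs <;> constructor <;> omega

/-- **The slab stays over the square**: the three vertices `z`, `z + e_κ`, `z + e_{κ'}` of every plaquette `(z; κ, κ')` of the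
slab swept when the square contour at `y` is displaced by `t e_ℓ` lie in the box `[y, y + N e_μ + N e_ν + t e_ℓ]`.
[cite: Federbush1987PhaseCellIII, §5.3 11) p. 305] -/
theorem slab_vertices_mem_box (y : LatticeContour.Site d') (μ ν ℓ : Fin d') (N t : ℕ) {q : LatticeContour.Plaq d'}
    (hq : q ∈ slabPlaqs ℓ (rectLoop y μ ν N N) t) :
    ∀ v : LatticeContour.Site d', (v = q.1 ∨ v = q.1 + ev q.2.1 ∨ v = q.1 + ev q.2.2) →
      ∀ i, y i ≤ v i ∧ v i ≤ (y + (N : ℤ) • ev μ + (N : ℤ) • ev ν + (t : ℤ) • ev ℓ) i := by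
  obtain ⟨l, hl, k, hk, -, hq⟩ := mem_slabPlaqs ℓ t q hq
  obtain ⟨hA, hB⟩ := endpoints_mem_square_of_mem_rectLoop y μ ν N hl
  have hk0 : (0 : ℤ) ≤ (k : ℤ) := by positivity
  have hkt : (k : ℤ) ≤ t := by exact_mod_cast hk.le
  have hk1 : ((k : ℤ) + 1) ≤ t := by exact_mod_cast hk
  have e1 : l.1.1 + (k : ℤ) • ev ℓ + ev l.1.2 = (l.1.1 + ev l.1.2) + (k : ℤ) • ev ℓ := by abel
  have e2 : l.1.1 + (k : ℤ) • ev ℓ + ev ℓ = l.1.1 + ((k : ℤ) + 1) • ev ℓ := by rw [add_smul, one_smul, add_assoc]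
  intro v hv
  rcases hq with rfl | rfl <;> simp only at hv <;> rcases hv with rfl | rfl | rfl
  · exact shift_mem_box hA ℓ hk0 hkt
  · rw [e1]; exact shift_mem_box hB ℓ hk0 hkt
  · rw [e2]; exact shift_mem_box hA ℓ (by positivity) hk1
  · exact shift_mem_box hA ℓ hk0 hkt
  · rw [e2]; exact shift_mem_box hA ℓ (by positivity) hk1
  · rw [e1]; exact shift_mem_box hB ℓ hk0 hkt

end SlabBox

section SlabSf

open LocalStabilitySU2D (InBoxZ side)

variable (d : ℕ)

/-- **In the scheme: the slab between two squares of the block lies in the four blocks.**  For `y` and `y + t e_{d+1}` in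
`block N 0` (`d ≧ 1`), the three vertices of every slab plaquette used by (5.39)'s displacement satisfy `InBoxZ` (the region
`[0, 2N)² × [0, N)^d` of the four `N^{d+2}` blocks). [cite: Federbush1987PhaseCellIII, §4 p. 298, §5.3 11) p. 305] -/
theorem inBoxZ_slab (hd : 1 ≤ d) {N : ℕ} {y : LatticeContour.Site (d + 2)} {t : ℕ} (hy : y ∈ block N (0 : LatticeContour.Site (d + 2)))
    (hyt : y + (t : ℤ) • ev (Fin.last (d + 1)) ∈ block N (0 : LatticeContour.Site (d + 2))) {q : LatticeContour.Plaq (d + 2)}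
    (hq : q ∈ slabPlaqs (Fin.last (d + 1)) (rectLoop y 0 1 N N) t) :
    InBoxZ d N q.1 ∧ InBoxZ d N (q.1 + ev q.2.1) ∧ InBoxZ d N (q.1 + ev q.2.2) := by
  have hv := slab_vertices_mem_box y (0 : Fin (d + 2)) 1 (Fin.last (d + 1)) N t hq
  obtain ⟨hℓ0, hℓ1⟩ := last_ne_zero_one d hd
  have e01 : (0 : Fin (d + 2)) ≠ 1 := by simp
  have key : ∀ v : LatticeContour.Site (d + 2), (∀ i, y i ≤ v i ∧ v i ≤
      (y + (N : ℤ) • ev (0 : Fin (d + 2)) + (N : ℤ) • ev (1 : Fin (d + 2)) + (t : ℤ) • ev (Fin.last (d + 1))) i) →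
      InBoxZ d N v := by
    intro v h k
    have hyk := (mem_block.1 hy) k
    have hytl := ((mem_block.1 hyt) (Fin.last (d + 1))).2
    have h' := h k
    have hsideN : N ≤ side d N k := by unfold side; split_ifs <;> omega
    have hsZ : (N : ℤ) ≤ (side d N k : ℤ) := by exact_mod_cast hsideN
    simp only [Pi.add_apply, Pi.smul_apply, smul_eq_mul, Pi.zero_apply, zero_add, ev_apply_self, mul_one] at h' hyk hytl
    refine ⟨by omega, ?_⟩
    by_cases hk0 : k = 0
    · subst hk0
      rw [ev_apply_self, ev_apply_of_ne e01, ev_apply_of_ne hℓ0.symm] at h'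
      have hs : (side d N (0 : Fin (d + 2)) : ℤ) = 2 * N := by simp [side]
      rw [hs]
      omega
    · by_cases hk1 : k = 1
      · subst hk1
        rw [ev_apply_of_ne (Ne.symm e01), ev_apply_self, ev_apply_of_ne hℓ1.symm] at h'
        have hs : (side d N (1 : Fin (d + 2)) : ℤ) = 2 * N := by simp [side]
        rw [hs]
        omega
      · by_cases hkl : k = Fin.last (d + 1)
        · subst hkl
          rw [ev_apply_of_ne hℓ0, ev_apply_of_ne hℓ1, ev_apply_self] at h'
          omega
        · rw [ev_apply_of_ne hk0, ev_apply_of_ne hk1, ev_apply_of_ne hkl] at h'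
          omega
  exact ⟨key _ (hv _ (Or.inl rfl)), key _ (hv _ (Or.inr (Or.inl rfl))), key _ (hv _ (Or.inr (Or.inr rfl)))⟩

end SlabSf

end GoodSquareTranslates

end Literature.MathematicalPhysics.QuantumFieldTheory.Federbush1986
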